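import Literature.Analysis.FluidPDE.CompressibleEulerImplosionOriginSeriesGrowth
import HarnessLib

/-!
# Buckmaster–Cao-Labora–Gómez-Serrano at `γ = 5/3`: pieces of the growth lemma of the sonic series (generic part)

Companion of `…SonicSeriesMajorant` / `…SonicMajorantWindow2` (crux `DenseExcursion`, line `sonic-cavity-renewal`, tail
engine of clause (e) of the cavity tube of the pinned profile). The growth lemma for the ordinary Taylor coefficients
`w_j`, `z_j` of the analytic branch at `P_s` is a strong induction on the sharp steps `abs_w_succ_succ_sharp`,
`abs_z_succ_succ_sharp` in the SCALED units `|w_j|/10^j`, `|z_j|/10^j` with weights of the shape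
`wt d Θ j = (j ≤ 60 ? d j : Θ/j³)` (head data `d`, tail constant `Θ`). This file is the generic, window-independent part:
the two convolution shapes of the steps,

* the DERIVATIVE shape `TL d₁ Θ₁ d₂ Θ₂ N k = wt₁(k+1)·(N−k+1)·wt₂(N−k+1)` (from `D_W W′`, `D_Z Z′`),
* the PRODUCT shape `TQ d₁ Θ₁ d₂ Θ₂ N e k = wt₁(k+1)·wt₂(N+e−k)`, `e ∈ {0, 1}` (from `N_W`, `N_Z`),

are bounded piece by piece (head × tail, tail × head, tail × tail), uniformly in `N ≥ 199` after division by
`Θ/(N+2)²`, by explicit rational functionals of the head data (`TL_head`, `TL_tailhead`, `TL_mid`, `TQ_head`, `TQ_tailhead`,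
`TQ_mid`); the monotonicity in `N` and the telescoping tail×tail sums are the lemmas `ratio_sq`, `ratio_cube`, `conv_sq_le`,
`conv_cube_le` of `…OriginSeriesGrowth`. No facts, no axioms.

[cite: BuckmasterCaolaboraGomezserrano2025, Prop. 2.3, eqs. (2.9)–(2.10), App. B]
-/

noncomputable section

open Finset

namespace Literature.Analysis.FluidPDE

namespace BuckmasterCaolaboraGomezserrano2025

namespace Monatomic

namespace SonicSeries

namespace Growth

open OriginSeries.CentreW2 (ratio_sq ratio_cube conv_sq_le conv_cube_le)

set_option linter.style.longLine false
set_option linter.style.setOption false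

/-! ### Weights -/

/-- The weight shape: head data `d j` for `j ≤ 60`, `Θ/j³` beyond. [folklore] -/
def wt (d : ℕ → ℝ) (Θ : ℝ) (j : ℕ) : ℝ := if j ≤ 60 then d j else Θ / (j : ℝ) ^ 3

/-- [folklore] -/
theorem wt_of_le {d : ℕ → ℝ} {Θ : ℝ} {j : ℕ} (h : j ≤ 60) : wt d Θ j = d j := by unfold wt; rw [if_pos h]

/-- [folklore] -/
theorem wt_of_lt {d : ℕ → ℝ} {Θ : ℝ} {j : ℕ} (h : 60 < j) : wt d Θ j = Θ / (j : ℝ) ^ 3 := by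
  unfold wt; rw [if_neg (by omega)]

/-- [folklore] -/
theorem wt_nonneg {d : ℕ → ℝ} {Θ : ℝ} (hd : ∀ j, j ≤ 60 → 0 ≤ d j) (hΘ : 0 ≤ Θ) (j : ℕ) : 0 ≤ wt d Θ j := by
  unfold wt; split_ifs with h
  · exact hd j h
  · positivity

/-- Linear combinations of weights are weights. [folklore] -/
theorem wt_comb (a b : ℝ) (d₁ d₂ : ℕ → ℝ) (Θ₁ Θ₂ : ℝ) (j : ℕ) :
    a * wt d₁ Θ₁ j + b * wt d₂ Θ₂ j = wt (fun i => a * d₁ i + b * d₂ i) (a * Θ₁ + b * Θ₂) j := by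
  unfold wt; split_ifs <;> ring

/-- `1/X² ≤ (1/P²)(201/Y)²` from `P²Y² ≤ 201²X²`. [folklore] -/
theorem key_sq {X P Y : ℝ} (hX : 0 < X) (hP : 0 < P) (hY : 0 < Y) (h : P ^ 2 * Y ^ 2 ≤ 201 ^ 2 * X ^ 2) :
    1 / X ^ 2 ≤ 1 / P ^ 2 * (201 / Y) ^ 2 := by
  rw [div_pow, div_mul_div_comm, one_mul, div_le_div_iff₀ (by positivity) (by positivity), one_mul]
  linarith

/-- `1/X³ ≤ (1/P²)(201²/Y³)` from `P²Y³ ≤ 201²X³`. [folklore] -/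
theorem key_cube {X P Y : ℝ} (hX : 0 < X) (hP : 0 < P) (hY : 0 < Y) (h : P ^ 2 * Y ^ 3 ≤ 201 ^ 2 * X ^ 3) :
    1 / X ^ 3 ≤ 1 / P ^ 2 * (201 ^ 2 / Y ^ 3) := by
  rw [div_mul_div_comm, one_mul, div_le_div_iff₀ (by positivity) (by positivity), one_mul]
  linarith

/-! ### The derivative shape `TL` -/

/-- The term `wt₁(k+1)·(N−k+1)·wt₂(N−k+1)` of a derivative convolution at level `N`. [folklore] -/
def TL (d₁ : ℕ → ℝ) (Θ₁ : ℝ) (d₂ : ℕ → ℝ) (Θ₂ : ℝ) (N k : ℕ) : ℝ :=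
  wt d₁ Θ₁ (k + 1) * ((((N - k : ℕ) : ℝ)) + 1) * wt d₂ Θ₂ (N - k + 1)

variable {d₁ d₂ : ℕ → ℝ} {Θ₁ Θ₂ : ℝ}

/-- Head × tail piece of `TL`: `k < 60`, `N ≥ 199`. [folklore] -/
theorem TL_head {N k : ℕ} (hN : 199 ≤ N) (hk : k < 60) (hd : 0 ≤ d₁ (k + 1)) (hΘ : 0 ≤ Θ₂) :
    TL d₁ Θ₁ d₂ Θ₂ N k ≤ Θ₂ / ((N : ℝ) + 2) ^ 2 * (d₁ (k + 1) * (201 / (200 - (k : ℝ))) ^ 2) := by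
  have hnk : ((N - k : ℕ) : ℝ) = (N : ℝ) - k := by rw [Nat.cast_sub (by omega)]
  unfold TL
  rw [wt_of_le (show k + 1 ≤ 60 by omega), wt_of_lt (show 60 < N - k + 1 by omega)]
  push_cast
  rw [hnk]
  have hr := ratio_sq (n := N + 1) (k := k) (by omega) (by omega)
  push_cast at hr
  have hik : (0 : ℝ) < (N : ℝ) - k + 1 := by
    have : ((k : ℕ) : ℝ) ≤ N := by exact_mod_cast (by omega : k ≤ N)
    linarith
  have h200 : (0 : ℝ) < 200 - (k : ℝ) := by
    have : ((k : ℕ) : ℝ) < 60 := by exact_mod_cast hk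
    linarith
  have hN2 : (0 : ℝ) < (N : ℝ) + 2 := by positivity
  have key : ((N : ℝ) - k + 1) * (1 / ((N : ℝ) - k + 1) ^ 3) ≤ 1 / ((N : ℝ) + 2) ^ 2 * (201 / (200 - (k : ℝ))) ^ 2 := by
    rw [show ((N : ℝ) - k + 1) * (1 / ((N : ℝ) - k + 1) ^ 3) = 1 / ((N : ℝ) - k + 1) ^ 2 by field_simp]
    refine key_sq hik hN2 h200 ?_
    have e : (N : ℝ) + 1 - k = (N : ℝ) - k + 1 := by ring
    rw [e] at hr
    nlinarith [hr]
  calc d₁ (k + 1) * ((N : ℝ) - k + 1) * (Θ₂ / ((N : ℝ) - k + 1) ^ 3)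
      = (d₁ (k + 1) * Θ₂) * (((N : ℝ) - k + 1) * (1 / ((N : ℝ) - k + 1) ^ 3)) := by ring
    _ ≤ (d₁ (k + 1) * Θ₂) * (1 / ((N : ℝ) + 2) ^ 2 * (201 / (200 - (k : ℝ))) ^ 2) :=
        mul_le_mul_of_nonneg_left key (mul_nonneg hd hΘ)
    _ = _ := by ring

/-- Tail × head piece of `TL`: `N − 59 ≤ k ≤ N` (so `i = N − k + 1 ∈ [1, 60]`), `N ≥ 199`. [folklore] -/
theorem TL_tailhead {N k : ℕ} (hN : 199 ≤ N) (hk1 : N - 59 ≤ k) (hk2 : k ≤ N) (hd : 0 ≤ d₂ (N - k + 1)) (hΘ : 0 ≤ Θ₁) :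
    TL d₁ Θ₁ d₂ Θ₂ N k ≤ Θ₁ / ((N : ℝ) + 2) ^ 2 *
      ((((N - k + 1 : ℕ) : ℝ)) * d₂ (N - k + 1) * (201 ^ 2 / (201 - ((N - k + 1 : ℕ) : ℝ)) ^ 3)) := by
  set i : ℕ := N - k + 1 with hi
  have hi1 : 1 ≤ i := by omega
  have hi60 : i ≤ 60 := by omega
  have hki : k + 1 = N + 2 - i := by omega
  have hnk : (((N - k : ℕ) : ℝ)) + 1 = (i : ℝ) := by rw [hi]; push_cast; ring
  unfold TL
  rw [wt_of_lt (show 60 < k + 1 by omega), wt_of_le hi60, hnk, hki]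
  have hiR : (1 : ℝ) ≤ i := by exact_mod_cast hi1
  have hi60R : (i : ℝ) ≤ 60 := by exact_mod_cast hi60
  have hcast : ((N + 2 - i : ℕ) : ℝ) = (N : ℝ) + 2 - i := by
    rw [Nat.cast_sub (by omega)]; push_cast; ring
  rw [hcast]
  have hr := ratio_cube (n := N + 1) (j := i) (by omega) (by omega)
  push_cast at hr
  have hpos1 : (0 : ℝ) < (N : ℝ) + 2 - i := by
    have : (199 : ℝ) ≤ N := by exact_mod_cast hN
    linarith
  have hpos2 : (0 : ℝ) < 201 - (i : ℝ) := by linarith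
  have hP : (0 : ℝ) < (N : ℝ) + 2 := by positivity
  have key : 1 / ((N : ℝ) + 2 - i) ^ 3 ≤ 1 / ((N : ℝ) + 2) ^ 2 * (201 ^ 2 / (201 - (i : ℝ)) ^ 3) := by
    refine key_cube hpos1 hP hpos2 ?_
    have e : (N : ℝ) + 1 + 1 - i = (N : ℝ) + 2 - i := by ring
    rw [e] at hr
    nlinarith [hr]
  calc Θ₁ / ((N : ℝ) + 2 - i) ^ 3 * (i : ℝ) * d₂ i
      = (Θ₁ * ((i : ℝ) * d₂ i)) * (1 / ((N : ℝ) + 2 - i) ^ 3) := by ring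
    _ ≤ (Θ₁ * ((i : ℝ) * d₂ i)) * (1 / ((N : ℝ) + 2) ^ 2 * (201 ^ 2 / (201 - (i : ℝ)) ^ 3)) :=
        mul_le_mul_of_nonneg_left key (mul_nonneg hΘ (mul_nonneg (by positivity) hd))
    _ = _ := by ring

/-- Tail × tail piece of `TL` (sum over `60 ≤ k ≤ N − 60`), `N ≥ 199`. [folklore] -/
theorem TL_mid {N : ℕ} (hN : 199 ≤ N) (hΘ₁ : 0 ≤ Θ₁) (hΘ₂ : 0 ≤ Θ₂) :
    ∑ k ∈ Ico 60 (N - 59), TL d₁ Θ₁ d₂ Θ₂ N k ≤ Θ₁ * Θ₂ / ((N : ℝ) + 2) ^ 2 * (2 / 61 / 60 + 1 / (60 * 61)) := by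
  have hconv := conv_sq_le (n := N + 1) (by omega)
  have e60 : N + 1 - 60 = N - 59 := by omega
  rw [e60] at hconv
  have hN2 : (0 : ℝ) < (N : ℝ) + 2 := by positivity
  have hterm : ∀ k ∈ Ico 60 (N - 59), TL d₁ Θ₁ d₂ Θ₂ N k ≤
      Θ₁ * Θ₂ / ((N : ℝ) + 2) ^ 2 * ((((N + 1 : ℕ) : ℝ) + 1) ^ 2 / (((k : ℝ) + 1) ^ 3 * (((N + 1 : ℕ) : ℝ) - k) ^ 2)) := by
    intro k hk
    rw [mem_Ico] at hk
    have hnk : ((N - k : ℕ) : ℝ) = (N : ℝ) - k := by rw [Nat.cast_sub (by omega)]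
    unfold TL
    rw [wt_of_lt (show 60 < k + 1 by omega), wt_of_lt (show 60 < N - k + 1 by omega)]
    push_cast
    rw [hnk]
    have hik : (0 : ℝ) < (N : ℝ) - k + 1 := by
      have : ((k : ℕ) : ℝ) + 59 < N := by
        have := (Nat.cast_lt (α := ℝ)).mpr (show k + 59 < N by omega); push_cast at this; linarith
      linarith
    have hk1 : (0 : ℝ) < (k : ℝ) + 1 := by positivity
    set X : ℝ := (N : ℝ) - k + 1 with hX
    have eX : (N : ℝ) + 1 - k = X := by rw [hX]; ring
    have eP : (N : ℝ) + 1 + 1 = (N : ℝ) + 2 := by ring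
    rw [eX, eP]
    have hXne : X ≠ 0 := hik.ne'
    have hk1ne : (k : ℝ) + 1 ≠ 0 := hk1.ne'
    have hN2ne : (N : ℝ) + 2 ≠ 0 := hN2.ne'
    apply le_of_eq
    field_simp
  refine (sum_le_sum hterm).trans ?_
  rw [← mul_sum]
  exact mul_le_mul_of_nonneg_left hconv (by positivity)

/-! ### The product shape `TQ` -/

/-- The term `wt₁(k+1)·wt₂(N+e−k)` of a product convolution (indices summing to `N + e + 1`). [folklore] -/
def TQ (d₁ : ℕ → ℝ) (Θ₁ : ℝ) (d₂ : ℕ → ℝ) (Θ₂ : ℝ) (N e k : ℕ) : ℝ :=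
  wt d₁ Θ₁ (k + 1) * wt d₂ Θ₂ (N + e - k)

/-- Head × tail piece of `TQ`: `k < 60`, `e ≤ 1`, `N ≥ 199`. [folklore] -/
theorem TQ_head {N e k : ℕ} (hN : 199 ≤ N) (he : e ≤ 1) (hk : k < 60) (hd : 0 ≤ d₁ (k + 1)) (hΘ : 0 ≤ Θ₂) :
    TQ d₁ Θ₁ d₂ Θ₂ N e k ≤ Θ₂ / ((N : ℝ) + 2) ^ 2 * (d₁ (k + 1) * (201 ^ 2 / (199 + (e : ℝ) - k) ^ 3)) := by
  have hnk : ((N + e - k : ℕ) : ℝ) = (N : ℝ) + e - k := by rw [Nat.cast_sub (by omega)]; push_cast; ring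
  unfold TQ
  rw [wt_of_le (show k + 1 ≤ 60 by omega), wt_of_lt (show 60 < N + e - k by omega), hnk]
  have hr := ratio_cube (n := N + 1) (j := k + 2 - e) (by omega) (by omega)
  have hj : ((k + 2 - e : ℕ) : ℝ) = (k : ℝ) + 2 - e := by rw [Nat.cast_sub (by omega)]; push_cast; ring
  rw [hj] at hr
  push_cast at hr
  have heR : (e : ℝ) ≤ 1 := by exact_mod_cast he
  have he0 : (0 : ℝ) ≤ e := by positivity
  have hkR : (k : ℝ) < 60 := by exact_mod_cast hk
  have hNR : (199 : ℝ) ≤ N := by exact_mod_cast hN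
  have hpos1 : (0 : ℝ) < (N : ℝ) + e - k := by linarith
  have hpos2 : (0 : ℝ) < 199 + (e : ℝ) - k := by linarith
  have hP : (0 : ℝ) < (N : ℝ) + 2 := by positivity
  have key : 1 / ((N : ℝ) + e - k) ^ 3 ≤ 1 / ((N : ℝ) + 2) ^ 2 * (201 ^ 2 / (199 + (e : ℝ) - k) ^ 3) := by
    refine key_cube hpos1 hP hpos2 ?_
    have e1 : (201 : ℝ) - ((k : ℝ) + 2 - e) = 199 + (e : ℝ) - k := by ring
    have e2 : (N : ℝ) + 1 + 1 - ((k : ℝ) + 2 - e) = (N : ℝ) + e - k := by ring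
    rw [e1, e2] at hr
    nlinarith [hr]
  calc d₁ (k + 1) * (Θ₂ / ((N : ℝ) + e - k) ^ 3) = (d₁ (k + 1) * Θ₂) * (1 / ((N : ℝ) + e - k) ^ 3) := by ring
    _ ≤ (d₁ (k + 1) * Θ₂) * (1 / ((N : ℝ) + 2) ^ 2 * (201 ^ 2 / (199 + (e : ℝ) - k) ^ 3)) :=
        mul_le_mul_of_nonneg_left key (mul_nonneg hd hΘ)
    _ = _ := by ring

/-- Tail × head piece of `TQ`: `N + e − 60 ≤ k < N + e` (so `l = N + e − k ∈ [1, 60]`), `N ≥ 199`. [folklore] -/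
theorem TQ_tailhead {N e k : ℕ} (hN : 199 ≤ N) (he : e ≤ 1) (hk1 : N + e - 60 ≤ k) (hk2 : k < N + e)
    (hd : 0 ≤ d₂ (N + e - k)) (hΘ : 0 ≤ Θ₁) :
    TQ d₁ Θ₁ d₂ Θ₂ N e k ≤ Θ₁ / ((N : ℝ) + 2) ^ 2 *
      (d₂ (N + e - k) * (201 ^ 2 / (200 + (e : ℝ) - ((N + e - k : ℕ) : ℝ)) ^ 3)) := by
  set l : ℕ := N + e - k with hl
  have hl1 : 1 ≤ l := by omega
  have hl60 : l ≤ 60 := by omega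
  have hkl : k + 1 = N + e + 1 - l := by omega
  unfold TQ
  rw [wt_of_lt (show 60 < k + 1 by omega), wt_of_le hl60, hkl]
  have hcast : ((N + e + 1 - l : ℕ) : ℝ) = (N : ℝ) + e + 1 - l := by rw [Nat.cast_sub (by omega)]; push_cast; ring
  rw [hcast]
  have hr := ratio_cube (n := N + 1) (j := l + 1 - e) (by omega) (by omega)
  have hj : ((l + 1 - e : ℕ) : ℝ) = (l : ℝ) + 1 - e := by rw [Nat.cast_sub (by omega)]; push_cast; ring
  rw [hj] at hr
  push_cast at hr
  have heR : (e : ℝ) ≤ 1 := by exact_mod_cast he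
  have he0 : (0 : ℝ) ≤ e := by positivity
  have hlR : (l : ℝ) ≤ 60 := by exact_mod_cast hl60
  have hNR : (199 : ℝ) ≤ N := by exact_mod_cast hN
  have hpos1 : (0 : ℝ) < (N : ℝ) + e + 1 - l := by linarith
  have hpos2 : (0 : ℝ) < 200 + (e : ℝ) - l := by linarith
  have hP : (0 : ℝ) < (N : ℝ) + 2 := by positivity
  have key : 1 / ((N : ℝ) + e + 1 - l) ^ 3 ≤ 1 / ((N : ℝ) + 2) ^ 2 * (201 ^ 2 / (200 + (e : ℝ) - l) ^ 3) := by
    refine key_cube hpos1 hP hpos2 ?_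
    have e1 : (201 : ℝ) - ((l : ℝ) + 1 - e) = 200 + (e : ℝ) - l := by ring
    have e2 : (N : ℝ) + 1 + 1 - ((l : ℝ) + 1 - e) = (N : ℝ) + e + 1 - l := by ring
    rw [e1, e2] at hr
    nlinarith [hr]
  calc Θ₁ / ((N : ℝ) + e + 1 - l) ^ 3 * d₂ l = (Θ₁ * d₂ l) * (1 / ((N : ℝ) + e + 1 - l) ^ 3) := by ring
    _ ≤ (Θ₁ * d₂ l) * (1 / ((N : ℝ) + 2) ^ 2 * (201 ^ 2 / (200 + (e : ℝ) - l) ^ 3)) :=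
        mul_le_mul_of_nonneg_left key (mul_nonneg hΘ hd)
    _ = _ := by ring

/-- Tail × tail piece of `TQ` (sum over `60 ≤ k < N + e − 60`), `N ≥ 199`. [folklore] -/
theorem TQ_mid {N e : ℕ} (hN : 199 ≤ N) (he : e ≤ 1) (hΘ₁ : 0 ≤ Θ₁) (hΘ₂ : 0 ≤ Θ₂) :
    ∑ k ∈ Ico 60 (N + e - 60), TQ d₁ Θ₁ d₂ Θ₂ N e k ≤
      Θ₁ * Θ₂ / ((N : ℝ) + 2) ^ 2 * ((201 / 200) ^ 2 * (4 / 61 / (2 * 60 * 61))) := by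
  have hconv := conv_cube_le (n := N + e) (by omega)
  have hN1 : (0 : ℝ) < ((N + e : ℕ) : ℝ) + 1 := by positivity
  have hN2 : (0 : ℝ) < (N : ℝ) + 2 := by positivity
  have heR : (e : ℝ) ≤ 1 := by exact_mod_cast he
  have he0 : (0 : ℝ) ≤ e := by positivity
  have hNR : (199 : ℝ) ≤ N := by exact_mod_cast hN
  -- `(N+2)² ≤ (201/200)² (N+e+1)²`
  have hcmp : ((N : ℝ) + 2) ^ 2 ≤ (201 / 200) ^ 2 * (((N + e : ℕ) : ℝ) + 1) ^ 2 := by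
    push_cast
    have h1 : (N : ℝ) + 2 ≤ 201 / 200 * ((N : ℝ) + e + 1) := by nlinarith
    have h0 : (0 : ℝ) ≤ (N : ℝ) + 2 := by positivity
    nlinarith [mul_le_mul h1 h1 h0 (by positivity)]
  have hterm : ∀ k ∈ Ico 60 (N + e - 60), TQ d₁ Θ₁ d₂ Θ₂ N e k =
      Θ₁ * Θ₂ / ((((N + e : ℕ) : ℝ)) + 1) ^ 2 *
        (((((N + e : ℕ) : ℝ)) + 1) ^ 2 / (((k : ℝ) + 1) ^ 3 * ((((N + e : ℕ) : ℝ)) - k) ^ 3)) := by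
    intro k hk
    rw [mem_Ico] at hk
    have hnk : ((N + e - k : ℕ) : ℝ) = (((N + e : ℕ) : ℝ)) - k := by
      rw [Nat.cast_sub (by omega)]
    unfold TQ
    rw [wt_of_lt (show 60 < k + 1 by omega), wt_of_lt (show 60 < N + e - k by omega), hnk]
    push_cast
    have hk1 : (0 : ℝ) < (k : ℝ) + 1 := by positivity
    have hik : (0 : ℝ) < (N : ℝ) + e - k := by
      have h60 : k + 60 < N + e := by omega
      have := (Nat.cast_lt (α := ℝ)).mpr h60
      push_cast at this
      linarith
    field_simp
  rw [sum_congr rfl hterm, ← mul_sum]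
  calc Θ₁ * Θ₂ / ((((N + e : ℕ) : ℝ)) + 1) ^ 2 *
        ∑ k ∈ Ico 60 (N + e - 60), ((((N + e : ℕ) : ℝ)) + 1) ^ 2 / (((k : ℝ) + 1) ^ 3 * ((((N + e : ℕ) : ℝ)) - k) ^ 3)
      ≤ Θ₁ * Θ₂ / ((((N + e : ℕ) : ℝ)) + 1) ^ 2 * (4 / 61 / (2 * 60 * 61)) :=
        mul_le_mul_of_nonneg_left hconv (by positivity)
    _ = Θ₁ * Θ₂ * (4 / 61 / (2 * 60 * 61)) * (1 / ((((N + e : ℕ) : ℝ)) + 1) ^ 2) := by ring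
    _ ≤ Θ₁ * Θ₂ * (4 / 61 / (2 * 60 * 61)) * ((201 / 200) ^ 2 / ((N : ℝ) + 2) ^ 2) := by
        refine mul_le_mul_of_nonneg_left ?_ (by positivity)
        rw [div_le_div_iff₀ (by positivity) (by positivity), one_mul]
        exact hcmp
    _ = _ := by ring

/-! ### Assembling a full convolution from its three pieces -/

/-- Splitting `Σ_{k<M}` at `60` and `M − c`. [folklore] -/
theorem sum_split3 (f : ℕ → ℝ) {M c : ℕ} (h1 : 60 ≤ M - c) (h2 : M - c ≤ M) :
    ∑ k ∈ range M, f k = ∑ k ∈ range 60, f k + ∑ k ∈ Ico 60 (M - c), f k + ∑ k ∈ Ico (M - c) M, f k := by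
  rw [← sum_range_add_sum_Ico _ (show 60 ≤ M by omega), ← sum_Ico_consecutive _ h1 h2]
  ring

/-- **The derivative convolution** `Σ_{k ≤ N} TL(N, k) ≤ (Θ₂·H + Θ₁·T + Θ₁Θ₂·C_sq)/(N+2)²` for `N ≥ 199`, where
`H = Σ_{k<60} d₁(k+1)(201/(200−k))²` and `T = Σ_{1 ≤ i ≤ 60} i·d₂(i)·201²/(201−i)³`. [folklore] -/
theorem sum_TL_le {N : ℕ} (hN : 199 ≤ N) (hd₁ : ∀ j, j ≤ 60 → 0 ≤ d₁ j) (hd₂ : ∀ j, j ≤ 60 → 0 ≤ d₂ j)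
    (hΘ₁ : 0 ≤ Θ₁) (hΘ₂ : 0 ≤ Θ₂) :
    ∑ k ∈ range (N + 1), TL d₁ Θ₁ d₂ Θ₂ N k ≤
      (Θ₂ * (∑ k ∈ range 60, d₁ (k + 1) * (201 / (200 - (k : ℝ))) ^ 2)
        + Θ₁ * (∑ i ∈ range 61, (i : ℝ) * d₂ i * (201 ^ 2 / (201 - (i : ℝ)) ^ 3))
        + Θ₁ * Θ₂ * (2 / 61 / 60 + 1 / (60 * 61))) / ((N : ℝ) + 2) ^ 2 := by
  rw [sum_split3 _ (M := N + 1) (c := 60) (by omega) (by omega), show N + 1 - 60 = N - 59 by omega]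
  have hU : (0 : ℝ) ≤ 1 / ((N : ℝ) + 2) ^ 2 := by positivity
  have h1 : ∑ k ∈ range 60, TL d₁ Θ₁ d₂ Θ₂ N k ≤
      Θ₂ / ((N : ℝ) + 2) ^ 2 * ∑ k ∈ range 60, d₁ (k + 1) * (201 / (200 - (k : ℝ))) ^ 2 := by
    rw [mul_sum]
    refine sum_le_sum fun k hk => ?_
    rw [mem_range] at hk
    exact TL_head hN hk (hd₁ _ (by omega)) hΘ₂
  have h2 := TL_mid (d₁ := d₁) (d₂ := d₂) hN hΘ₁ hΘ₂
  have h3 : ∑ k ∈ Ico (N - 59) (N + 1), TL d₁ Θ₁ d₂ Θ₂ N k ≤ Θ₁ / ((N : ℝ) + 2) ^ 2 *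
      ∑ k ∈ Ico (N - 59) (N + 1), (((N - k + 1 : ℕ) : ℝ)) * d₂ (N - k + 1) * (201 ^ 2 / (201 - ((N - k + 1 : ℕ) : ℝ)) ^ 3) := by
    rw [mul_sum]
    refine sum_le_sum fun k hk => ?_
    rw [mem_Ico] at hk
    exact TL_tailhead hN hk.1 (by omega) (hd₂ _ (by omega)) hΘ₁
  have hrefl : ∑ k ∈ Ico (N - 59) (N + 1), (((N - k + 1 : ℕ) : ℝ)) * d₂ (N - k + 1) * (201 ^ 2 / (201 - ((N - k + 1 : ℕ) : ℝ)) ^ 3)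
      = ∑ i ∈ range 61, (i : ℝ) * d₂ i * (201 ^ 2 / (201 - (i : ℝ)) ^ 3) := by
    have h := sum_Ico_reflect (fun i : ℕ => (i : ℝ) * d₂ i * (201 ^ 2 / (201 - (i : ℝ)) ^ 3)) (N - 59)
      (m := N + 1) (n := N + 1) (by omega)
    have e1 : N + 1 + 1 - (N + 1) = 1 := by omega
    have e2 : N + 1 + 1 - (N - 59) = 61 := by omega
    rw [e1, e2] at h
    have e3 : ∑ k ∈ Ico (N - 59) (N + 1), (((N - k + 1 : ℕ) : ℝ)) * d₂ (N - k + 1) * (201 ^ 2 / (201 - ((N - k + 1 : ℕ) : ℝ)) ^ 3)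
        = ∑ k ∈ Ico (N - 59) (N + 1), (fun i : ℕ => (i : ℝ) * d₂ i * (201 ^ 2 / (201 - (i : ℝ)) ^ 3)) (N + 1 - k) := by
      refine sum_congr rfl fun k hk => ?_
      rw [mem_Ico] at hk
      simp only [show N + 1 - k = N - k + 1 by omega]
    rw [e3, h, ← sum_range_add_sum_Ico _ (show 1 ≤ 61 by norm_num)]
    simp
  rw [hrefl] at h3
  have := add_le_add (add_le_add h1 h2) h3
  refine this.trans (le_of_eq ?_)
  field_simp
  ring

/-- **The product convolution** `Σ_{k<N+e} TQ(N, e, k) ≤ (Θ₂·H + Θ₁·T + Θ₁Θ₂·C)/(N+2)²` for `N ≥ 199`, `e ≤ 1`, where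
`H = Σ_{k<60} d₁(k+1)·201²/(199+e−k)³`, `T = Σ_{1≤l≤60} d₂(l)·201²/(200+e−l)³`, `C = (201/200)²·C_cube`. [folklore] -/
theorem sum_TQ_le {N e : ℕ} (hN : 199 ≤ N) (he : e ≤ 1) (hd₁ : ∀ j, j ≤ 60 → 0 ≤ d₁ j) (hd₂ : ∀ j, j ≤ 60 → 0 ≤ d₂ j)
    (hΘ₁ : 0 ≤ Θ₁) (hΘ₂ : 0 ≤ Θ₂) :
    ∑ k ∈ range (N + e), TQ d₁ Θ₁ d₂ Θ₂ N e k ≤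
      (Θ₂ * (∑ k ∈ range 60, d₁ (k + 1) * (201 ^ 2 / (199 + (e : ℝ) - k) ^ 3))
        + Θ₁ * (∑ l ∈ range 61, d₂ l * (201 ^ 2 / (200 + (e : ℝ) - l) ^ 3) - d₂ 0 * (201 ^ 2 / (200 + (e : ℝ)) ^ 3))
        + Θ₁ * Θ₂ * ((201 / 200) ^ 2 * (4 / 61 / (2 * 60 * 61)))) / ((N : ℝ) + 2) ^ 2 := by
  rw [sum_split3 _ (M := N + e) (c := 60) (by omega) (by omega)]
  have h1 : ∑ k ∈ range 60, TQ d₁ Θ₁ d₂ Θ₂ N e k ≤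
      Θ₂ / ((N : ℝ) + 2) ^ 2 * ∑ k ∈ range 60, d₁ (k + 1) * (201 ^ 2 / (199 + (e : ℝ) - k) ^ 3) := by
    rw [mul_sum]
    refine sum_le_sum fun k hk => ?_
    rw [mem_range] at hk
    exact TQ_head hN he hk (hd₁ _ (by omega)) hΘ₂
  have h2 := TQ_mid (d₁ := d₁) (d₂ := d₂) hN he hΘ₁ hΘ₂
  have h3 : ∑ k ∈ Ico (N + e - 60) (N + e), TQ d₁ Θ₁ d₂ Θ₂ N e k ≤ Θ₁ / ((N : ℝ) + 2) ^ 2 *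
      ∑ k ∈ Ico (N + e - 60) (N + e), d₂ (N + e - k) * (201 ^ 2 / (200 + (e : ℝ) - ((N + e - k : ℕ) : ℝ)) ^ 3) := by
    rw [mul_sum]
    refine sum_le_sum fun k hk => ?_
    rw [mem_Ico] at hk
    exact TQ_tailhead hN he hk.1 hk.2 (hd₂ _ (by omega)) hΘ₁
  have hrefl : ∑ k ∈ Ico (N + e - 60) (N + e), d₂ (N + e - k) * (201 ^ 2 / (200 + (e : ℝ) - ((N + e - k : ℕ) : ℝ)) ^ 3)
      = ∑ l ∈ range 61, d₂ l * (201 ^ 2 / (200 + (e : ℝ) - l) ^ 3) - d₂ 0 * (201 ^ 2 / (200 + (e : ℝ)) ^ 3) := by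
    have h := sum_Ico_reflect (fun l : ℕ => d₂ l * (201 ^ 2 / (200 + (e : ℝ) - l) ^ 3)) (N + e - 60)
      (m := N + e) (n := N + e) (by omega)
    have e1 : N + e + 1 - (N + e) = 1 := by omega
    have e2 : N + e + 1 - (N + e - 60) = 61 := by omega
    rw [e1, e2] at h
    have e3 : ∑ k ∈ Ico (N + e - 60) (N + e), d₂ (N + e - k) * (201 ^ 2 / (200 + (e : ℝ) - ((N + e - k : ℕ) : ℝ)) ^ 3)
        = ∑ k ∈ Ico (N + e - 60) (N + e), (fun l : ℕ => d₂ l * (201 ^ 2 / (200 + (e : ℝ) - l) ^ 3)) (N + e - k) :=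
      sum_congr rfl fun k _ => rfl
    rw [e3, h]
    have hsplit := sum_range_add_sum_Ico (fun l : ℕ => d₂ l * (201 ^ 2 / (200 + (e : ℝ) - l) ^ 3)) (show 1 ≤ 61 by norm_num)
    simp only [sum_range_one, Nat.cast_zero, sub_zero] at hsplit
    linarith
  rw [hrefl] at h3
  have := add_le_add (add_le_add h1 h2) h3
  refine this.trans (le_of_eq ?_)
  field_simp
  ring

end Growth

end SonicSeries

end Monatomic

end BuckmasterCaolaboraGomezserrano2025

end Literature.Analysis.FluidPDE
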